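import Summits.KontsevichZagierPeriods.KontsevichZagierPeriods.Theorems.HermiteRigidityIslandComplementCubeReflection

/-!
# `ReductionRigidity` (stmt-KontsevichZagierPeriods-3407), line `Sketch`, stub `stub_landenRat`:
# the Landen certificate at a rational point, I — the regular rational primitives on `□³`
# (`stub_landenRatPrimitives`)

Route `KontsevichZagierPeriods/HermiteRigidity`, crux `ReductionRigidity` (stmt-3407), growth line
`bloch-suslin-rational-dilog`, worker stub `stub_landenRat`, part 1 (registered sub-goal stub
`stub_landenRatPrimitives`). Landen's identity `Li₂(a) + Li₂(a/(a−1)) = −½ log²(1−a)` at a RATIONAL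
point `a ∈ (0,1)` becomes a chain of cubical moves through the extra variable `t ∈ [0,1]` (the argument
is deformed to `a·t`). This file is the rational-parameter version of
`HermiteRigidityIslandComplementLandenPrimitives.lean` (the case `a = 1/N`): it supplies the seven
regular rational functions on the closed cube `□³` (coordinates `x = p₀`, `y = p₁`, `t = p₂`) of the
certificate, with their values and the values of the relevant formal partial derivatives (quotient
rule, `KZ.RFun.pd`), in the shape of the EXACTNESS identities they satisfy:

* `F₁ = at/(1 − axyt)`,        `G₁ = ax/(1 − axyt)`:                 `∂ₜF₁ = ∂ₓG₁ = a/(1 − axyt)²`;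
* `F₂ = −at/(1 − at + axyt)`,  `G₂ = −ax/((1 − at)(1 − at + axyt))`: `∂ₜF₂ = ∂ₓG₂ = −a/(1 − at + axyt)²`;
* `F₃ = a²t²/((1 − axt)(1 − ayt))`, `G₃ = a²xt/((1 − axt)(1 − ayt))`, `H₃ = a²yt/((1 − axt)(1 − ayt))`:
  `∂ₜF₃ = ∂ₓG₃ + ∂_yH₃` with `∂ₓG₃ = a²t/((1 − axt)²(1 − ayt))`, `∂_yH₃ = a²t/((1 − axt)(1 − ayt)²)`

(`Fₖ(x, y, t) = Eₖ(x, y, at)` for the dilogarithm kernels `E₁ = z/(1 − xyz)` of `Li₂(z)`,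
`E₂ = −z/((1 − z) + xyz)` of `Li₂(z/(z − 1))`, `E₃ = z²/((1 − xz)(1 − yz))` of `log²(1 − z)`).
All denominators are `≥ 1 − a > 0` on the closed cube for `0 < a < 1`, so every function is regular
there; the partial derivatives are computed symbolically (`rfun_pd_fn_eq`, `MvPolynomial.pderiv`).

References: M. Kontsevich, D. Zagier, *Periods* (2001), §1.1–§1.2 [cite: KontsevichZagier2001, §1.2].
No definitions are introduced (the functions are delivered existentially with their values).
-/

noncomputable section

open MeasureTheory Set MvPolynomial

namespace Summit.KontsevichZagierPeriods.HermiteRigidity.ReductionRigidity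

open Literature.NumberTheory.Transcendental
open Literature.NumberTheory.Transcendental.KZ

/-! ## Bounds on the closed cube `□³` -/

/-- On `□³` (`0 < a < 1`) the five denominators of the certificate are positive:
`1 − axyt`, `1 − at`, `1 − at + axyt`, `1 − axt`, `1 − ayt`. [folklore] -/
theorem landenRat_den_pos {a : ℚ} (ha₀ : 0 < a) (ha₁ : a < 1) {p : Fin 3 → ℝ} (hp : p ∈ cube 3) :
    0 < 1 - (a : ℝ) * p 0 * p 1 * p 2 ∧ 0 < 1 - (a : ℝ) * p 2 ∧
      0 < 1 - (a : ℝ) * p 2 + (a : ℝ) * p 0 * p 1 * p 2 ∧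
      0 < 1 - (a : ℝ) * p 0 * p 2 ∧ 0 < 1 - (a : ℝ) * p 1 * p 2 := by
  have ha : (0:ℝ) < a := by exact_mod_cast ha₀
  have ha' : (a:ℝ) < 1 := by exact_mod_cast ha₁
  have h0 := hp 0; have h1 := hp 1; have h2 := hp 2
  have h01 : 0 ≤ p 0 * p 1 ∧ p 0 * p 1 ≤ 1 := ⟨mul_nonneg h0.1 h1.1, mul_le_one₀ h0.2 h1.1 h1.2⟩
  have h012 : 0 ≤ p 0 * p 1 * p 2 ∧ p 0 * p 1 * p 2 ≤ 1 :=
    ⟨mul_nonneg h01.1 h2.1, mul_le_one₀ h01.2 h2.1 h2.2⟩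
  have h02 : p 0 * p 2 ≤ 1 := mul_le_one₀ h0.2 h2.1 h2.2
  have h12 : p 1 * p 2 ≤ 1 := mul_le_one₀ h1.2 h2.1 h2.2
  have b012 := mul_le_of_le_one_right ha.le h012.2
  have b012' := mul_nonneg ha.le h012.1
  have b2 := mul_le_of_le_one_right ha.le h2.2
  have b02 := mul_le_of_le_one_right ha.le h02
  have b12 := mul_le_of_le_one_right ha.le h12
  have e012 : (a : ℝ) * p 0 * p 1 * p 2 = a * (p 0 * p 1 * p 2) := by ring
  have e02 : (a : ℝ) * p 0 * p 2 = a * (p 0 * p 2) := by ring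
  have e12 : (a : ℝ) * p 1 * p 2 = a * (p 1 * p 2) := by ring
  rw [e012, e02, e12]
  exact ⟨by linarith, by linarith, by linarith, by linarith, by linarith⟩

/-! ## The seven functions: values and derivative values -/

/-- `F₁ = at/(1 − axyt)` on `□³`, with `∂ₜF₁ = a/(1 − axyt)²`. [cite: KontsevichZagier2001, §1.1] -/
theorem exists_landenRat_F₁ {a : ℚ} (ha₀ : 0 < a) (ha₁ : a < 1) : ∃ T : RFun 3,
    (∀ p ∈ cube 3, T.fn p = (a : ℝ) * p 2 / (1 - (a : ℝ) * p 0 * p 1 * p 2)) ∧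
    (∀ p ∈ cube 3, (T.pd 2).fn p = (a : ℝ) / (1 - (a : ℝ) * p 0 * p 1 * p 2) ^ 2) := by
  have hden : ∀ p ∈ cube 3,
      aeval p (1 - C a * X 0 * X 1 * X 2 : MvPolynomial (Fin 3) ℚ) ≠ 0 := by
    intro p hp
    have h := (landenRat_den_pos ha₀ ha₁ hp).1
    simp only [map_sub, map_one, map_mul, aeval_C, aeval_X, eq_ratCast]
    exact h.ne'
  refine ⟨⟨C a * X 2, _, hden⟩, fun p _ => ?_, fun p hp => ?_⟩
  · simp only [RFun.fn_apply, map_sub, map_one, map_mul, aeval_C, aeval_X, eq_ratCast]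
  · have hne := (landenRat_den_pos ha₀ ha₁ hp).1.ne'
    rw [rfun_pd_fn_eq]
    simp only [map_sub, map_one, map_mul, pderiv_mul, pderiv_C, pderiv_one, pderiv_X, aeval_C,
      aeval_X, eq_ratCast]
    norm_num [Pi.single_apply, Fin.ext_iff]
    field_simp
    ring

/-- `G₁ = ax/(1 − axyt)` on `□³`, with `∂ₓG₁ = a/(1 − axyt)²`. [cite: KontsevichZagier2001, §1.1] -/
theorem exists_landenRat_G₁ {a : ℚ} (ha₀ : 0 < a) (ha₁ : a < 1) : ∃ T : RFun 3,
    (∀ p ∈ cube 3, T.fn p = (a : ℝ) * p 0 / (1 - (a : ℝ) * p 0 * p 1 * p 2)) ∧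
    (∀ p ∈ cube 3, (T.pd 0).fn p = (a : ℝ) / (1 - (a : ℝ) * p 0 * p 1 * p 2) ^ 2) := by
  have hden : ∀ p ∈ cube 3,
      aeval p (1 - C a * X 0 * X 1 * X 2 : MvPolynomial (Fin 3) ℚ) ≠ 0 := by
    intro p hp
    have h := (landenRat_den_pos ha₀ ha₁ hp).1
    simp only [map_sub, map_one, map_mul, aeval_C, aeval_X, eq_ratCast]
    exact h.ne'
  refine ⟨⟨C a * X 0, _, hden⟩, fun p _ => ?_, fun p hp => ?_⟩
  · simp only [RFun.fn_apply, map_sub, map_one, map_mul, aeval_C, aeval_X, eq_ratCast]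
  · have hne := (landenRat_den_pos ha₀ ha₁ hp).1.ne'
    rw [rfun_pd_fn_eq]
    simp only [map_sub, map_one, map_mul, pderiv_mul, pderiv_C, pderiv_one, pderiv_X, aeval_C,
      aeval_X, eq_ratCast]
    norm_num [Pi.single_apply, Fin.ext_iff]
    field_simp
    ring

/-- `F₂ = −at/(1 − at + axyt)` on `□³`, with `∂ₜF₂ = −a/(1 − at + axyt)²`.
[cite: KontsevichZagier2001, §1.1] -/
theorem exists_landenRat_F₂ {a : ℚ} (ha₀ : 0 < a) (ha₁ : a < 1) : ∃ T : RFun 3,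
    (∀ p ∈ cube 3, T.fn p = -((a : ℝ) * p 2) / (1 - (a : ℝ) * p 2 + (a : ℝ) * p 0 * p 1 * p 2)) ∧
    (∀ p ∈ cube 3, (T.pd 2).fn p =
      -(a : ℝ) / (1 - (a : ℝ) * p 2 + (a : ℝ) * p 0 * p 1 * p 2) ^ 2) := by
  have hden : ∀ p ∈ cube 3,
      aeval p (1 - C a * X 2 + C a * X 0 * X 1 * X 2 : MvPolynomial (Fin 3) ℚ) ≠ 0 := by
    intro p hp
    have h := (landenRat_den_pos ha₀ ha₁ hp).2.2.1
    simp only [map_sub, map_add, map_one, map_mul, aeval_C, aeval_X, eq_ratCast]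
    exact h.ne'
  refine ⟨⟨-(C a * X 2), _, hden⟩, fun p _ => ?_, fun p hp => ?_⟩
  · simp only [RFun.fn_apply, map_sub, map_add, map_neg, map_one, map_mul, aeval_C, aeval_X,
      eq_ratCast]
  · have hne := (landenRat_den_pos ha₀ ha₁ hp).2.2.1.ne'
    rw [rfun_pd_fn_eq]
    simp only [map_sub, map_add, map_neg, map_one, map_mul, pderiv_mul, pderiv_C, pderiv_one,
      pderiv_X, aeval_C, aeval_X, eq_ratCast]
    norm_num [Pi.single_apply, Fin.ext_iff]
    field_simp
    ring

/-- `G₂ = −ax/((1 − at)(1 − at + axyt))` on `□³`, with `∂ₓG₂ = −a/(1 − at + axyt)²`.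
[cite: KontsevichZagier2001, §1.1] -/
theorem exists_landenRat_G₂ {a : ℚ} (ha₀ : 0 < a) (ha₁ : a < 1) : ∃ T : RFun 3,
    (∀ p ∈ cube 3, T.fn p =
      -((a : ℝ) * p 0) / ((1 - (a : ℝ) * p 2) * (1 - (a : ℝ) * p 2 + (a : ℝ) * p 0 * p 1 * p 2))) ∧
    (∀ p ∈ cube 3, (T.pd 0).fn p =
      -(a : ℝ) / (1 - (a : ℝ) * p 2 + (a : ℝ) * p 0 * p 1 * p 2) ^ 2) := by
  have hden : ∀ p ∈ cube 3,
      aeval p ((1 - C a * X 2) * (1 - C a * X 2 + C a * X 0 * X 1 * X 2) :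
        MvPolynomial (Fin 3) ℚ) ≠ 0 := by
    intro p hp
    have h := landenRat_den_pos ha₀ ha₁ hp
    simp only [map_sub, map_add, map_one, map_mul, aeval_C, aeval_X, eq_ratCast]
    exact mul_ne_zero h.2.1.ne' h.2.2.1.ne'
  refine ⟨⟨-(C a * X 0), _, hden⟩, fun p _ => ?_, fun p hp => ?_⟩
  · simp only [RFun.fn_apply, map_sub, map_add, map_neg, map_one, map_mul, aeval_C, aeval_X,
      eq_ratCast]
  · have h := landenRat_den_pos ha₀ ha₁ hp
    have ht := h.2.1.ne'
    have h2 := h.2.2.1.ne'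
    rw [rfun_pd_fn_eq]
    simp only [map_sub, map_add, map_neg, map_one, map_mul, pderiv_mul, pderiv_C, pderiv_one,
      pderiv_X, aeval_C, aeval_X, eq_ratCast]
    norm_num [Pi.single_apply, Fin.ext_iff]
    field_simp
    ring

/-- `F₃ = a²t²/((1 − axt)(1 − ayt))` on `□³`, with
`∂ₜF₃ = a²t/((1 − axt)²(1 − ayt)) + a²t/((1 − axt)(1 − ayt)²)`. [cite: KontsevichZagier2001, §1.1] -/
theorem exists_landenRat_F₃ {a : ℚ} (ha₀ : 0 < a) (ha₁ : a < 1) : ∃ T : RFun 3,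
    (∀ p ∈ cube 3, T.fn p =
      (a : ℝ) ^ 2 * p 2 ^ 2 / ((1 - (a : ℝ) * p 0 * p 2) * (1 - (a : ℝ) * p 1 * p 2))) ∧
    (∀ p ∈ cube 3, (T.pd 2).fn p =
      (a : ℝ) ^ 2 * p 2 / ((1 - (a : ℝ) * p 0 * p 2) ^ 2 * (1 - (a : ℝ) * p 1 * p 2)) +
        (a : ℝ) ^ 2 * p 2 / ((1 - (a : ℝ) * p 0 * p 2) * (1 - (a : ℝ) * p 1 * p 2) ^ 2)) := by
  have hden : ∀ p ∈ cube 3,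
      aeval p ((1 - C a * X 0 * X 2) * (1 - C a * X 1 * X 2) : MvPolynomial (Fin 3) ℚ) ≠ 0 := by
    intro p hp
    have h := landenRat_den_pos ha₀ ha₁ hp
    simp only [map_sub, map_one, map_mul, aeval_C, aeval_X, eq_ratCast]
    exact mul_ne_zero h.2.2.2.1.ne' h.2.2.2.2.ne'
  refine ⟨⟨C a ^ 2 * X 2 ^ 2, _, hden⟩, fun p _ => ?_, fun p hp => ?_⟩
  · simp only [RFun.fn_apply, map_sub, map_one, map_mul, map_pow, aeval_C, aeval_X, eq_ratCast]
  · have h := landenRat_den_pos ha₀ ha₁ hp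
    have hx := h.2.2.2.1.ne'
    have hy := h.2.2.2.2.ne'
    rw [rfun_pd_fn_eq]
    simp only [map_sub, map_one, map_mul, map_pow, pderiv_mul, pderiv_pow, pderiv_C, pderiv_one,
      pderiv_X, aeval_C, aeval_X, eq_ratCast]
    norm_num [Pi.single_apply, Fin.ext_iff]
    field_simp
    ring

/-- `G₃ = a²xt/((1 − axt)(1 − ayt))` on `□³`, with `∂ₓG₃ = a²t/((1 − axt)²(1 − ayt))`.
[cite: KontsevichZagier2001, §1.1] -/
theorem exists_landenRat_G₃ {a : ℚ} (ha₀ : 0 < a) (ha₁ : a < 1) : ∃ T : RFun 3,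
    (∀ p ∈ cube 3, T.fn p =
      (a : ℝ) ^ 2 * p 0 * p 2 / ((1 - (a : ℝ) * p 0 * p 2) * (1 - (a : ℝ) * p 1 * p 2))) ∧
    (∀ p ∈ cube 3, (T.pd 0).fn p =
      (a : ℝ) ^ 2 * p 2 / ((1 - (a : ℝ) * p 0 * p 2) ^ 2 * (1 - (a : ℝ) * p 1 * p 2))) := by
  have hden : ∀ p ∈ cube 3,
      aeval p ((1 - C a * X 0 * X 2) * (1 - C a * X 1 * X 2) : MvPolynomial (Fin 3) ℚ) ≠ 0 := by
    intro p hp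
    have h := landenRat_den_pos ha₀ ha₁ hp
    simp only [map_sub, map_one, map_mul, aeval_C, aeval_X, eq_ratCast]
    exact mul_ne_zero h.2.2.2.1.ne' h.2.2.2.2.ne'
  refine ⟨⟨C a ^ 2 * X 0 * X 2, _, hden⟩, fun p _ => ?_, fun p hp => ?_⟩
  · simp only [RFun.fn_apply, map_sub, map_one, map_mul, map_pow, aeval_C, aeval_X, eq_ratCast]
  · have h := landenRat_den_pos ha₀ ha₁ hp
    have hx := h.2.2.2.1.ne'
    have hy := h.2.2.2.2.ne'
    rw [rfun_pd_fn_eq]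
    simp only [map_sub, map_one, map_mul, map_pow, pderiv_mul, pderiv_pow, pderiv_C, pderiv_one,
      pderiv_X, aeval_C, aeval_X, eq_ratCast]
    norm_num [Pi.single_apply, Fin.ext_iff]
    field_simp
    ring

/-- `H₃ = a²yt/((1 − axt)(1 − ayt))` on `□³`, with `∂_yH₃ = a²t/((1 − axt)(1 − ayt)²)`.
[cite: KontsevichZagier2001, §1.1] -/
theorem exists_landenRat_H₃ {a : ℚ} (ha₀ : 0 < a) (ha₁ : a < 1) : ∃ T : RFun 3,
    (∀ p ∈ cube 3, T.fn p =
      (a : ℝ) ^ 2 * p 1 * p 2 / ((1 - (a : ℝ) * p 0 * p 2) * (1 - (a : ℝ) * p 1 * p 2))) ∧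
    (∀ p ∈ cube 3, (T.pd 1).fn p =
      (a : ℝ) ^ 2 * p 2 / ((1 - (a : ℝ) * p 0 * p 2) * (1 - (a : ℝ) * p 1 * p 2) ^ 2)) := by
  have hden : ∀ p ∈ cube 3,
      aeval p ((1 - C a * X 0 * X 2) * (1 - C a * X 1 * X 2) : MvPolynomial (Fin 3) ℚ) ≠ 0 := by
    intro p hp
    have h := landenRat_den_pos ha₀ ha₁ hp
    simp only [map_sub, map_one, map_mul, aeval_C, aeval_X, eq_ratCast]
    exact mul_ne_zero h.2.2.2.1.ne' h.2.2.2.2.ne'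
  refine ⟨⟨C a ^ 2 * X 1 * X 2, _, hden⟩, fun p _ => ?_, fun p hp => ?_⟩
  · simp only [RFun.fn_apply, map_sub, map_one, map_mul, map_pow, aeval_C, aeval_X, eq_ratCast]
  · have h := landenRat_den_pos ha₀ ha₁ hp
    have hx := h.2.2.2.1.ne'
    have hy := h.2.2.2.2.ne'
    rw [rfun_pd_fn_eq]
    simp only [map_sub, map_one, map_mul, map_pow, pderiv_mul, pderiv_pow, pderiv_C, pderiv_one,
      pderiv_X, aeval_C, aeval_X, eq_ratCast]
    norm_num [Pi.single_apply, Fin.ext_iff]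
    field_simp
    ring

/-! ## The registered sub-goal stub -/

/-- **Stub `stub_landenRatPrimitives`** (sub-goal of crux `ReductionRigidity`, stmt-3407, line `Sketch`,
growth line `bloch-suslin-rational-dilog`, part 1 of worker stub `stub_landenRat`): for every rational
`0 < a < 1` the seven regular rational functions `F₁, G₁, F₂, G₂, F₃, G₃, H₃` on the closed cube `□³`
realising the Landen certificate at `a` exist, with the stated values and the stated values of
`∂ₜF₁, ∂ₓG₁, ∂ₜF₂, ∂ₓG₂, ∂ₜF₃, ∂ₓG₃, ∂_yH₃` on the cube — in particular `∂ₜF₁ = ∂ₓG₁`, `∂ₜF₂ = ∂ₓG₂`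
and `∂ₜF₃ = ∂ₓG₃ + ∂_yH₃` pointwise (the exactness behind the dimension-raising Stokes move).
[cite: KontsevichZagier2001, §1.2 rule (3)] -/
theorem stub_landenRatPrimitives :
    ∀ (a : ℚ), 0 < a → a < 1 → ∃ F₁ G₁ F₂ G₂ F₃ G₃ H₃ : RFun 3,
      (∀ p ∈ cube 3, F₁.fn p = (a : ℝ) * p 2 / (1 - (a : ℝ) * p 0 * p 1 * p 2)) ∧
      (∀ p ∈ cube 3, (F₁.pd 2).fn p = (a : ℝ) / (1 - (a : ℝ) * p 0 * p 1 * p 2) ^ 2) ∧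
      (∀ p ∈ cube 3, G₁.fn p = (a : ℝ) * p 0 / (1 - (a : ℝ) * p 0 * p 1 * p 2)) ∧
      (∀ p ∈ cube 3, (G₁.pd 0).fn p = (a : ℝ) / (1 - (a : ℝ) * p 0 * p 1 * p 2) ^ 2) ∧
      (∀ p ∈ cube 3, F₂.fn p =
        -((a : ℝ) * p 2) / (1 - (a : ℝ) * p 2 + (a : ℝ) * p 0 * p 1 * p 2)) ∧
      (∀ p ∈ cube 3, (F₂.pd 2).fn p =
        -(a : ℝ) / (1 - (a : ℝ) * p 2 + (a : ℝ) * p 0 * p 1 * p 2) ^ 2) ∧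
      (∀ p ∈ cube 3, G₂.fn p =
        -((a : ℝ) * p 0) / ((1 - (a : ℝ) * p 2) * (1 - (a : ℝ) * p 2 + (a : ℝ) * p 0 * p 1 * p 2))) ∧
      (∀ p ∈ cube 3, (G₂.pd 0).fn p =
        -(a : ℝ) / (1 - (a : ℝ) * p 2 + (a : ℝ) * p 0 * p 1 * p 2) ^ 2) ∧
      (∀ p ∈ cube 3, F₃.fn p =
        (a : ℝ) ^ 2 * p 2 ^ 2 / ((1 - (a : ℝ) * p 0 * p 2) * (1 - (a : ℝ) * p 1 * p 2))) ∧
      (∀ p ∈ cube 3, (F₃.pd 2).fn p =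
        (a : ℝ) ^ 2 * p 2 / ((1 - (a : ℝ) * p 0 * p 2) ^ 2 * (1 - (a : ℝ) * p 1 * p 2)) +
          (a : ℝ) ^ 2 * p 2 / ((1 - (a : ℝ) * p 0 * p 2) * (1 - (a : ℝ) * p 1 * p 2) ^ 2)) ∧
      (∀ p ∈ cube 3, G₃.fn p =
        (a : ℝ) ^ 2 * p 0 * p 2 / ((1 - (a : ℝ) * p 0 * p 2) * (1 - (a : ℝ) * p 1 * p 2))) ∧
      (∀ p ∈ cube 3, (G₃.pd 0).fn p =
        (a : ℝ) ^ 2 * p 2 / ((1 - (a : ℝ) * p 0 * p 2) ^ 2 * (1 - (a : ℝ) * p 1 * p 2))) ∧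
      (∀ p ∈ cube 3, H₃.fn p =
        (a : ℝ) ^ 2 * p 1 * p 2 / ((1 - (a : ℝ) * p 0 * p 2) * (1 - (a : ℝ) * p 1 * p 2))) ∧
      (∀ p ∈ cube 3, (H₃.pd 1).fn p =
        (a : ℝ) ^ 2 * p 2 / ((1 - (a : ℝ) * p 0 * p 2) * (1 - (a : ℝ) * p 1 * p 2) ^ 2)) := by
  intro a ha₀ ha₁
  obtain ⟨F₁, hF₁, hF₁'⟩ := exists_landenRat_F₁ ha₀ ha₁
  obtain ⟨G₁, hG₁, hG₁'⟩ := exists_landenRat_G₁ ha₀ ha₁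
  obtain ⟨F₂, hF₂, hF₂'⟩ := exists_landenRat_F₂ ha₀ ha₁
  obtain ⟨G₂, hG₂, hG₂'⟩ := exists_landenRat_G₂ ha₀ ha₁
  obtain ⟨F₃, hF₃, hF₃'⟩ := exists_landenRat_F₃ ha₀ ha₁
  obtain ⟨G₃, hG₃, hG₃'⟩ := exists_landenRat_G₃ ha₀ ha₁
  obtain ⟨H₃, hH₃, hH₃'⟩ := exists_landenRat_H₃ ha₀ ha₁
  exact ⟨F₁, G₁, F₂, G₂, F₃, G₃, H₃, hF₁, hF₁', hG₁, hG₁', hF₂, hF₂', hG₂, hG₂', hF₃, hF₃', hG₃,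
    hG₃', hH₃, hH₃'⟩

end Summit.KontsevichZagierPeriods.HermiteRigidity.ReductionRigidity

end
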